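import Summits.HodgeConjecture.CorCM.MultiFieldWeilUnitGramFour
import HarnessLib

/-!
# MULTI-FIELD WEIL ENGINE — UNIT SEPARATION IS SHARP: dependent centred indicators give non-constant defects solving the signed equations for EVERY permutation (census level)

Cell `pub-hodgecm2` (COR-CM), seat b30 gen 40 (2026-08-26); count-neutral own lane MULTI-FIELD WEIL ENGINE (stem `MultiFieldWeil*`), census level, the CONVERSE of
`CorCM/MultiFieldWeilUnitSeparation.lean` (U1 `const_of_signed_unit_of_linearIndependent`: for a product-closed `2`-transitive `H ⊆ Sym(k)` the signed equations
`Σ_i Σ_a ±_{σ a ∈ Q_i} u_i(a) = w` (`σ ∈ H`) force every defect `u_i` to be constant as soon as the centred indicators `k·𝟙_{Q_i} − |Q_i|·𝟙` are linearly independent over `ℚ`).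
Theorems only; no definition, no named fact, no `sorry`.  HONEST FRAMING: pure finite combinatorics; `HC_CM` is NOT touched.

**`exists_nonconst_signed_of_not_linearIndependent`.**  If `k ≥ 2` and the centred indicators of `Q : ι → Finset (Fin k)` are linearly DEPENDENT over `ℚ`, there are
integer defects `u_i`, one of them NON-CONSTANT, whose signed sums `Σ_i Σ_a ±_{σ a ∈ Q_i} u_i(a)` vanish for EVERY permutation `σ` of the letters (so for every `H`, with `w = 0`).
Construction: a dependency `Σ_i g_i (k·𝟙_{Q_i} − |Q_i|) = 0` with `g_{i₀} ≠ 0`, cleared of denominators (`z_i = g_i·∏_j den g_j ∈ ℤ`), times the mass-zero weight `𝟙_{a₀} − 𝟙_{a₁}`: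
`u_i = z_i·(𝟙_{a₀} − 𝟙_{a₁})`; the signed sum is `Σ_a (𝟙_{a₀} − 𝟙_{a₁})(a)·T(σ a)` with `T(y) = Σ_i ±_{y ∈ Q_i} z_i` CONSTANT in `y` (`k·T(y) = 2Σ_i z_i|Q_i| − kΣ_i z_i` by the
dependency), hence zero.  So U1's criterion is an EQUIVALENCE for the method: the shapes of `CorCM/MultiFieldWeilUnitsMenuShapes.lean` (and G1's rank bound) are exactly its reach.
[cite: Lang2002, XIII §4] [cite: DixonMortimer1996, §2.1]

## References
* [Lang2002] S. Lang, *Algebra*, GTM 211, XIII §4 (linear independence, rank).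
* [DixonMortimer1996] J. D. Dixon, B. Mortimer, *Permutation Groups*, GTM 163, §2.1.
-/

noncomputable section

namespace Summit.HodgeConjecture.CorCM.MultiFieldWeil

open Finset

open scoped Classical

section Sharp

variable {k : ℕ}

/-- Clearing denominators of finitely many rationals: `g_i · ∏_j den(g_j)` is the integer `num(g_i) · ∏_{j ≠ i} den(g_j)`. [folklore] -/
theorem cast_num_mul_prod_den {ι : Type} [Fintype ι] (g : ι → ℚ) (i : ι) :
    (((g i).num * ∏ j ∈ Finset.univ.erase i, ((g j).den : ℤ) : ℤ) : ℚ) = g i * ∏ j, ((g j).den : ℚ) := by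
  rw [← Finset.mul_prod_erase Finset.univ (fun j => ((g j).den : ℚ)) (Finset.mem_univ i), ← mul_assoc, Rat.mul_den_eq_num]
  push_cast
  rfl

/-- **UNIT SEPARATION IS SHARP.**  `k ≥ 2`; if the centred indicators `k·𝟙_{Q_i} − |Q_i|` are linearly dependent over `ℚ`, some family of integer defects with a
NON-CONSTANT member solves the signed equations `Σ_i Σ_a ±_{σ a ∈ Q_i} u_i(a) = 0` for EVERY permutation `σ`. [cite: Lang2002, XIII §4] [cite: DixonMortimer1996, §2.1] -/
theorem exists_nonconst_signed_of_not_linearIndependent (hk : 2 ≤ k) {ι : Type} [Fintype ι] (Q : ι → Finset (Fin k))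
    (hdep : ¬ LinearIndependent ℚ fun i : ι => fun q : Fin k => ((k : ℚ) * (if q ∈ Q i then 1 else 0) - (Q i).card)) :
    ∃ u : ι → Fin k → ℤ, (∃ i b b', u i b ≠ u i b') ∧ ∀ σ : Equiv.Perm (Fin k), (∑ i, ∑ a : Fin k, (if σ a ∈ Q i then u i a else -u i a)) = 0 := by
  obtain ⟨g, hg, i₀, hi₀⟩ := Fintype.not_linearIndependent_iff.1 hdep
  have hpt := apply_cells_eq_zero_of_sum_smul_eq_zero Q hg
  -- integer multiples of the dependency
  let z : ι → ℤ := fun i => (g i).num * ∏ j ∈ Finset.univ.erase i, ((g j).den : ℤ)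
  have hz : ∀ i, (z i : ℚ) = g i * ∏ j, ((g j).den : ℚ) := fun i => cast_num_mul_prod_den g i
  have hz₀ : z i₀ ≠ 0 :=
    mul_ne_zero (Rat.num_ne_zero.2 hi₀) (Finset.prod_ne_zero_iff.2 fun j _ => by exact_mod_cast (g j).den_ne_zero)
  -- the signed weights `T(y) = Σ_i ±_{y ∈ Q_i} z_i` are constant in `y`
  have hT : ∀ y y' : Fin k, (∑ i, (if y ∈ Q i then z i else -z i)) = ∑ i, (if y' ∈ Q i then z i else -z i) := by
    have hcell : ∀ y : Fin k, (∑ i, z i * ((k : ℤ) * (if y ∈ Q i then 1 else 0) - (Q i).card)) = 0 := fun y => by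
      have h : (∑ i, (z i : ℚ) * ((k : ℚ) * (if y ∈ Q i then 1 else 0) - (Q i).card)) = 0 := by
        rw [Finset.sum_congr rfl fun i _ => by rw [hz i]]
        calc (∑ i, g i * (∏ j, ((g j).den : ℚ)) * ((k : ℚ) * (if y ∈ Q i then 1 else 0) - (Q i).card))
            = (∏ j, ((g j).den : ℚ)) * ∑ i, g i * ((k : ℚ) * (if y ∈ Q i then 1 else 0) - (Q i).card) := by
              rw [Finset.mul_sum]; exact Finset.sum_congr rfl fun i _ => by ring
          _ = 0 := by rw [hpt y, mul_zero]
      exact_mod_cast h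
    have hkT : ∀ y : Fin k, (k : ℤ) * (∑ i, (if y ∈ Q i then z i else -z i)) = 2 * (∑ i, z i * (Q i).card) - (k : ℤ) * ∑ i, z i := fun y => by
      have e : (k : ℤ) * (∑ i, (if y ∈ Q i then z i else -z i)) - (2 * (∑ i, z i * (Q i).card) - (k : ℤ) * ∑ i, z i) =
          2 * ∑ i, z i * ((k : ℤ) * (if y ∈ Q i then 1 else 0) - (Q i).card) := by
        rw [Finset.mul_sum, Finset.mul_sum, Finset.mul_sum, Finset.mul_sum, ← Finset.sum_sub_distrib, ← Finset.sum_sub_distrib]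
        refine Finset.sum_congr rfl fun i _ => ?_
        split_ifs <;> ring
      rw [hcell y, mul_zero, sub_eq_zero] at e
      exact e
    intro y y'
    have hk0 : (k : ℤ) ≠ 0 := by exact_mod_cast (show k ≠ 0 by omega)
    exact mul_left_cancel₀ hk0 (by rw [hkT y, hkT y'])
  -- two letters and the mass-zero weight `𝟙_{a₀} − 𝟙_{a₁}`
  let a₀ : Fin k := ⟨0, by omega⟩
  let a₁ : Fin k := ⟨1, by omega⟩
  have h01 : a₀ ≠ a₁ := fun h => by have := congrArg Fin.val h; simp [a₀, a₁] at this
  let w : Fin k → ℤ := fun a => (if a = a₀ then 1 else 0) - (if a = a₁ then 1 else 0)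
  have hw : (∑ a : Fin k, w a) = 0 := by
    simp only [w, Finset.sum_sub_distrib, Finset.sum_ite_eq', Finset.mem_univ, if_true, sub_self]
  refine ⟨fun i a => z i * w a, ⟨i₀, a₀, a₁, ?_⟩, fun σ => ?_⟩
  · -- `u_{i₀}(a₀) = z_{i₀} ≠ −z_{i₀} = u_{i₀}(a₁)`
    have h0 : w a₀ = 1 := by simp [w, h01]
    have h1 : w a₁ = -1 := by simp [w, h01.symm]
    show z i₀ * w a₀ ≠ z i₀ * w a₁
    rw [h0, h1]
    omega
  · -- the signed sum: `Σ_a w(a)·T(σ a) = T · Σ_a w(a) = 0`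
    calc (∑ i, ∑ a : Fin k, (if σ a ∈ Q i then z i * w a else -(z i * w a)))
        = ∑ a : Fin k, w a * ∑ i, (if σ a ∈ Q i then z i else -z i) := by
          rw [Finset.sum_comm]
          refine Finset.sum_congr rfl fun a _ => ?_
          rw [Finset.mul_sum]
          refine Finset.sum_congr rfl fun i _ => ?_
          split_ifs <;> ring
      _ = ∑ a : Fin k, w a * ∑ i, (if a₀ ∈ Q i then z i else -z i) := Finset.sum_congr rfl fun a _ => by rw [hT (σ a) a₀]
      _ = 0 := by rw [← Finset.sum_mul, hw, zero_mul]

/-- **THE CRITERION IS AN EQUIVALENCE** (for `k ≥ 2`): the centred indicators are linearly independent over `ℚ` iff every family of integer defects solving the signed equations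
for all permutations (constant `0`) is constant. [cite: Lang2002, XIII §4] [cite: DixonMortimer1996, §2.1] -/
theorem linearIndependent_cells_iff_forall_signed_const (hk : 2 ≤ k) {ι : Type} [Fintype ι] (Q : ι → Finset (Fin k)) :
    (LinearIndependent ℚ fun i : ι => fun q : Fin k => ((k : ℚ) * (if q ∈ Q i then 1 else 0) - (Q i).card)) ↔
      ∀ u : ι → Fin k → ℤ, (∀ σ : Equiv.Perm (Fin k), (∑ i, ∑ a : Fin k, (if σ a ∈ Q i then u i a else -u i a)) = 0) → ∀ i b b', u i b = u i b' := by
  refine ⟨fun hli u hu i b b' => ?_, fun h => ?_⟩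
  · -- U1 with `H = Sym(k)` (closed under products, `2`-transitive for `k ≥ 2`)
    refine const_of_signed_unit_of_linearIndependent (H := Finset.univ) (fun σ _ σ' _ => Finset.mem_univ _) (fun a a' c c' haa hcc => ?_) Q u
      (w := 0) (fun σ _ => hu σ) hli i b b'
    -- `Sym(k)` is `2`-transitive: `σ = (d c') ∘ (a c)` with `d = (a c)(a')`
    have hdc : Equiv.swap a c a' ≠ c := fun h => haa ((Equiv.swap a c).injective ((Equiv.swap_apply_left a c).trans h.symm))
    refine ⟨Equiv.swap (Equiv.swap a c a') c' * Equiv.swap a c, Finset.mem_univ _, ?_, ?_⟩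
    · rw [Equiv.Perm.mul_apply, Equiv.swap_apply_left, Equiv.swap_apply_of_ne_of_ne hdc.symm hcc]
    · rw [Equiv.Perm.mul_apply, Equiv.swap_apply_left]
  · by_contra hdep
    obtain ⟨u, ⟨i, b, b', hne⟩, hu⟩ := exists_nonconst_signed_of_not_linearIndependent hk Q hdep
    exact hne (h u hu i b b')

end Sharp

end Summit.HodgeConjecture.CorCM.MultiFieldWeil

end
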